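import Mathlib
import Literature.AlgebraicGeometry.Resolution.ExceptionalCurveDegree
import Literature.AlgebraicGeometry.Resolution.PrimeDivisorIdeals
import Literature.AlgebraicGeometry.Resolution.BlowupsProduct
import Literature.AlgebraicGeometry.Resolution.DivisorialPartLemmas
import Literature.AlgebraicGeometry.Resolution.MarkedIdealsLemmas
import Literature.AlgebraicGeometry.Motives.CartierDivisorOfIdealSheaf
import Literature.AlgebraicGeometry.Motives.AbelianVarietyTheoremOfCube
import HarnessLib

/-!
# [OURS · L1 w44b] K-PCC sheaf half, FILE 1a: the Cartier divisor of a product of invertible ideal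
# sheaves is the sum, and the intersection number of a CYCLE DIVISOR is linear in the cycle

Rung S-2 `HomologicalConductor.PersistenceSurface` (stmt-ResolutionOfSingularities-19970) of route
`ResolutionOfSingularities/HomologicalConductor`, chain W4.4b (cell res-hironaka), WAVE-3 row «stub-3 → K-PCC
SHEAF HALF» of the lead memo K-PCC (res-L1-w44b-lead-1 g4, `L/res-L1-w44b-lead-1/K-PCC.md`; lattice half
`…PersistencePointedCycles`). `[OURS · L1 w44b]` — folklore bookkeeping in the W4.4 `NoZeno` resolution
vocabulary (`excCurvePoints`, `excCurveDegree`, `primeDivisorIdeal`, `CartierDivisor.ofIsEffectiveCartier`);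
replaces the role of no printed item; NOT a statement of the manuscript under review and nothing of it is
used; AI-written, weaker than expert review. DECL MAP: `L/res-L1-w44b-stub-3/g8/KPCC-SHEAF-DECLMAP.md`.

For an integral scheme `X` and ideal sheaves `I`, `J` locally generated by one regular element
(`IsEffectiveCartier`):

* `stalkIdeal_eq_span_germ_cartierGen_of_mem` — on the chart of `x`, the stalk `I_y` at any `y` of the chart
  is generated by the germ of the chart generator; `isUnitAt_div_of_span_singleton_eq` — two germs generating
  the same ideal of `𝒪_{X,y}` define rational functions whose quotient is a unit at `y`;
* **`ofIsEffectiveCartier_mul_sameDivisor`**: `D_{IJ}` and `D_I + D_J` are the SAME Cartier divisor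
  (`CartierDivisor.SameDivisor`: `(IJ)_y = I_y J_y` is generated both by the generator of `IJ` and by the
  product of the generators, which are therefore associated in the domain `𝒪_{X,y}`);
  `ofIsEffectiveCartier_top_sameDivisor_zero`: `D_⊤ = 0`;
* for `π : X → Spec T` proper over a local ring and an integral exceptional curve `η` (`excCurvePoints`):
  **`excCurveDegree_ofIsEffectiveCartier_mul / _top / _pow / _finset_prod`** — `(𝒪_X(D_{IJ})·E_η) =
  (𝒪_X(D_I)·E_η) + (𝒪_X(D_J)·E_η)` etc. (tree `excCurveDegree_add`, `excCurveDegree_congr_linEquiv`);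
* **`excCurveDegree_cycleDivisor`** — on a REGULAR `X`, for a finite set `F` of codimension-one points and a
  cycle `W : X → ℕ`, the divisor `D_W` of the cycle ideal `∏_{η ∈ F} 𝓘_{E_η}^{W η}` (W4.4, `…NoZenoCycleDivisor`)
  has `(𝒪_X(D_W)·E_{η₀}) = Σ_{η ∈ F} W η · (𝒪_X([E_η])·E_{η₀})` — the entry `Σ_j W_j M j i` of the lead's lattice
  pairing with **`M j i := excCurveDegree π [E_j] η_i`**; `excCurveDegree_primeDivisor_nonneg_of_ne`: the
  off-diagonal entries are `≥ 0` (the lattice hypothesis `hoff` of `…PersistencePointedCycles`).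

References: U. Görtz, T. Wedhorn, *Algebraic Geometry I* (2nd ed. 2020), (11.9), Remark 11.27, (11.12)
[`GortzWedhorn2020`]; J. Lipman, Publ. Math. IHÉS 36 (1969), §12 Remark 2 b)–c) (p. 221) [`Lipman1969`].
-/

set_option linter.dupNamespace false
set_option autoImplicit false

noncomputable section

open CategoryTheory AlgebraicGeometry TopologicalSpace IsLocalRing Opposite Order
open Literature.AlgebraicGeometry.Motives Literature.AlgebraicGeometry.Motives.RatFn
open Literature.AlgebraicGeometry.Resolution

universe u

namespace Summit.ResolutionOfSingularities.ResolutionOfSingularities.Theorems.HomologicalConductor.PersistencePointedCeiling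

variable {X : Scheme.{u}} [IsIntegral X]

/-! ## Germs of chart generators -/

omit [IsIntegral X] in
/-- On the chart of `x`, the stalk `I_y` at every point `y` of the chart is generated by the germ at `y` of
the chart generator. [cite: GortzWedhorn2020, Remark 11.27 (pp. 378–379)] -/
theorem stalkIdeal_eq_span_germ_cartierGen_of_mem (I : X.IdealSheafData) (hI : IsEffectiveCartier I)
    {x y : X} (hy : y ∈ (CartierDivisor.cartierChart I hI x : X.Opens)) :
    stalkIdeal I y = Ideal.span {(X.presheaf.germ _ y hy).hom (CartierDivisor.cartierGen I hI x)} := by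
  rw [stalkIdeal_eq_map_germ I (CartierDivisor.cartierChart I hI x) hy, CartierDivisor.ideal_cartierChart,
    Ideal.map_span, Set.image_singleton]

/-- The germ of a chart generator is non-zero. [folklore] -/
theorem germ_cartierGen_ne_zero (I : X.IdealSheafData) (hI : IsEffectiveCartier I)
    {x y : X} (hy : y ∈ (CartierDivisor.cartierChart I hI x : X.Opens)) :
    (X.presheaf.germ _ y hy).hom (CartierDivisor.cartierGen I hI x) ≠ 0 := by
  intro h0
  apply (CartierDivisor.ofIsEffectiveCartier I hI).f_ne_zero x
  rw [CartierDivisor.ofIsEffectiveCartier_f,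
    ← toFunctionField_germ_eq_secFn (CartierDivisor.mem_cartierChart I hI x) hy, h0, map_zero]

/-- **Associated germs define rational functions differing by a unit**: if `(γ) = (δ)` in `𝒪_{X,y}` and
`δ ≠ 0` then `γ/δ` is a unit at `y`. [folklore] -/
theorem isUnitAt_div_of_span_singleton_eq {y : X} {γ δ : X.presheaf.stalk y}
    (h : Ideal.span ({γ} : Set (X.presheaf.stalk y)) = Ideal.span {δ}) (hδ : δ ≠ 0) :
    IsUnitAt y (toFunctionField y γ / toFunctionField y δ) := by
  obtain ⟨u, hu⟩ := Ideal.span_singleton_eq_span_singleton.mp h.symm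
  -- `δ * u = γ`
  have hδ' : toFunctionField y δ ≠ 0 := (map_ne_zero_iff _ (toFunctionField_injective y)).mpr hδ
  refine ⟨u, ?_⟩
  rw [eq_div_iff hδ', ← hu, map_mul, mul_comm]

/-! ## `D_{IJ} = D_I + D_J`, `D_⊤ = 0` -/

/-- **The Cartier divisor of a product of invertible ideal sheaves is the sum**: `D_{IJ}` and `D_I + D_J`
have associated local equations at every point (`(IJ)_y = I_y · J_y`). [cite: GortzWedhorn2020, Section (11.9) and Remark 11.27] -/
theorem ofIsEffectiveCartier_mul_sameDivisor (I J : X.IdealSheafData) (hI : IsEffectiveCartier I)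
    (hJ : IsEffectiveCartier J) (hIJ : IsEffectiveCartier (I * J)) :
    (CartierDivisor.ofIsEffectiveCartier (I * J) hIJ).SameDivisor
      (CartierDivisor.ofIsEffectiveCartier I hI + CartierDivisor.ofIsEffectiveCartier J hJ) := by
  rintro x ⟨x₁, x₂⟩ y hy ⟨hy₁, hy₂⟩
  have hy' : y ∈ (CartierDivisor.cartierChart (I * J) hIJ x : X.Opens) := hy
  have hy₁' : y ∈ (CartierDivisor.cartierChart I hI x₁ : X.Opens) := hy₁
  have hy₂' : y ∈ (CartierDivisor.cartierChart J hJ x₂ : X.Opens) := hy₂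
  change IsUnitAt y (secFn (CartierDivisor.mem_cartierChart (I * J) hIJ x)
      (CartierDivisor.cartierGen (I * J) hIJ x) /
    (secFn (CartierDivisor.mem_cartierChart I hI x₁) (CartierDivisor.cartierGen I hI x₁) *
      secFn (CartierDivisor.mem_cartierChart J hJ x₂) (CartierDivisor.cartierGen J hJ x₂)))
  have h : Ideal.span {(X.presheaf.germ _ y hy').hom (CartierDivisor.cartierGen (I * J) hIJ x)} =
      Ideal.span {(X.presheaf.germ _ y hy₁').hom (CartierDivisor.cartierGen I hI x₁) *
        (X.presheaf.germ _ y hy₂').hom (CartierDivisor.cartierGen J hJ x₂)} := by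
    rw [← Ideal.span_singleton_mul_span_singleton, ← stalkIdeal_eq_span_germ_cartierGen_of_mem I hI hy₁',
      ← stalkIdeal_eq_span_germ_cartierGen_of_mem J hJ hy₂',
      ← stalkIdeal_eq_span_germ_cartierGen_of_mem (I * J) hIJ hy', stalkIdeal_mul]
  have hu := isUnitAt_div_of_span_singleton_eq h
    (mul_ne_zero (germ_cartierGen_ne_zero I hI hy₁') (germ_cartierGen_ne_zero J hJ hy₂'))
  rwa [map_mul, toFunctionField_germ_eq_secFn (CartierDivisor.mem_cartierChart (I * J) hIJ x) hy',
    toFunctionField_germ_eq_secFn (CartierDivisor.mem_cartierChart I hI x₁) hy₁',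
    toFunctionField_germ_eq_secFn (CartierDivisor.mem_cartierChart J hJ x₂) hy₂'] at hu

/-- **The Cartier divisor of the unit ideal sheaf is zero**: its local equations are units.
[cite: GortzWedhorn2020, (13.19) (p. 413)] -/
theorem ofIsEffectiveCartier_top_sameDivisor_zero (h : IsEffectiveCartier (⊤ : X.IdealSheafData)) :
    (CartierDivisor.ofIsEffectiveCartier ⊤ h).SameDivisor 0 := by
  intro x j y hy _
  have hy' : y ∈ (CartierDivisor.cartierChart ⊤ h x : X.Opens) := hy
  change IsUnitAt y (secFn (CartierDivisor.mem_cartierChart ⊤ h x) (CartierDivisor.cartierGen ⊤ h x) / 1)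
  have h1 : Ideal.span {(X.presheaf.germ _ y hy').hom (CartierDivisor.cartierGen ⊤ h x)} =
      Ideal.span {(1 : X.presheaf.stalk y)} := by
    rw [← stalkIdeal_eq_span_germ_cartierGen_of_mem ⊤ h hy', stalkIdeal_top, Ideal.span_singleton_one]
  have hu := isUnitAt_div_of_span_singleton_eq h1 one_ne_zero
  rwa [map_one, toFunctionField_germ_eq_secFn (CartierDivisor.mem_cartierChart ⊤ h x) hy'] at hu

/-! ## Intersection numbers of products -/

section Degree

variable {T : Type u} [CommRing T] [IsLocalRing T] [IsLocallyNoetherian X] (π : X ⟶ Spec (.of T))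
  [IsProper π]

/-- `(𝒪_X(D_{IJ})·E_η) = (𝒪_X(D_I)·E_η) + (𝒪_X(D_J)·E_η)`. [cite: Lipman1969, Section 12, Remark 2 b) (p. 221)] -/
theorem excCurveDegree_ofIsEffectiveCartier_mul {η : X} (hη : η ∈ excCurvePoints π)
    (I J : X.IdealSheafData) (hI : IsEffectiveCartier I) (hJ : IsEffectiveCartier J)
    (hIJ : IsEffectiveCartier (I * J)) :
    excCurveDegree π (CartierDivisor.ofIsEffectiveCartier (I * J) hIJ) η =
      excCurveDegree π (CartierDivisor.ofIsEffectiveCartier I hI) η +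
        excCurveDegree π (CartierDivisor.ofIsEffectiveCartier J hJ) η := by
  rw [excCurveDegree_congr_linEquiv π hη (ofIsEffectiveCartier_mul_sameDivisor I J hI hJ hIJ).linEquiv,
    excCurveDegree_add π hη]

/-- `(𝒪_X(D_⊤)·E_η) = 0`. [cite: Lipman1969, Section 12, Remark 2 b) (p. 221)] -/
theorem excCurveDegree_ofIsEffectiveCartier_top {η : X} (hη : η ∈ excCurvePoints π)
    (h : IsEffectiveCartier (⊤ : X.IdealSheafData)) :
    excCurveDegree π (CartierDivisor.ofIsEffectiveCartier ⊤ h) η = 0 := by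
  rw [excCurveDegree_congr_linEquiv π hη (ofIsEffectiveCartier_top_sameDivisor_zero h).linEquiv]
  exact excCurveDegree_zero π hη

omit [IsLocalRing T] [IsProper π] in
/-- Equal ideal sheaves have Cartier divisors with equal intersection numbers (transport of the
invertibility witness). [folklore] -/
theorem excCurveDegree_ofIsEffectiveCartier_congr {I J : X.IdealSheafData} (e : I = J)
    (hI : IsEffectiveCartier I) (hJ : IsEffectiveCartier J) (η : X) :
    excCurveDegree π (CartierDivisor.ofIsEffectiveCartier I hI) η =
      excCurveDegree π (CartierDivisor.ofIsEffectiveCartier J hJ) η := by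
  subst e
  rfl

/-- `(𝒪_X(D_{Iⁿ})·E_η) = n · (𝒪_X(D_I)·E_η)`. [cite: Lipman1969, Section 12, Remark 2 b) (p. 221)] -/
theorem excCurveDegree_ofIsEffectiveCartier_pow {η : X} (hη : η ∈ excCurvePoints π)
    (I : X.IdealSheafData) (hI : IsEffectiveCartier I) (n : ℕ) (h : IsEffectiveCartier (I ^ n)) :
    excCurveDegree π (CartierDivisor.ofIsEffectiveCartier (I ^ n) h) η =
      n * excCurveDegree π (CartierDivisor.ofIsEffectiveCartier I hI) η := by
  induction n with
  | zero =>
    rw [excCurveDegree_ofIsEffectiveCartier_congr π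
      ((pow_zero I).trans Scheme.IdealSheafData.one_eq_top) h isEffectiveCartier_top,
      excCurveDegree_ofIsEffectiveCartier_top π hη, Nat.cast_zero, zero_mul]
  | succ n ih =>
    rw [excCurveDegree_ofIsEffectiveCartier_congr π (pow_succ I n) h ((hI.pow n).mul hI),
      excCurveDegree_ofIsEffectiveCartier_mul π hη _ _ (hI.pow n) hI, ih (hI.pow n)]
    push_cast
    ring

/-- `(𝒪_X(D_{∏ Kᵢ})·E_η) = Σᵢ (𝒪_X(D_{Kᵢ})·E_η)` for a finite family of invertible ideal sheaves.
[cite: Lipman1969, Section 12, Remark 2 b) (p. 221)] -/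
theorem excCurveDegree_ofIsEffectiveCartier_finset_prod {η : X} (hη : η ∈ excCurvePoints π)
    {ι : Type*} (s : Finset ι) (K : ι → X.IdealSheafData) (hK : ∀ i, IsEffectiveCartier (K i))
    (h : IsEffectiveCartier (∏ i ∈ s, K i)) :
    excCurveDegree π (CartierDivisor.ofIsEffectiveCartier (∏ i ∈ s, K i) h) η =
      ∑ i ∈ s, excCurveDegree π (CartierDivisor.ofIsEffectiveCartier (K i) (hK i)) η := by
  classical
  induction s using Finset.induction_on with
  | empty =>
    rw [Finset.sum_empty, excCurveDegree_ofIsEffectiveCartier_congr π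
      (Finset.prod_empty.trans Scheme.IdealSheafData.one_eq_top) h isEffectiveCartier_top]
    exact excCurveDegree_ofIsEffectiveCartier_top π hη _
  | insert i s hi ih =>
    rw [Finset.sum_insert hi, excCurveDegree_ofIsEffectiveCartier_congr π (Finset.prod_insert hi) h
      ((hK i).mul (IsEffectiveCartier.finset_prod s fun j _ => hK j)),
      excCurveDegree_ofIsEffectiveCartier_mul π hη _ _ (hK i)
        (IsEffectiveCartier.finset_prod s fun j _ => hK j), ih]

/-! ## Cycle divisors on a regular scheme -/

/-- **The intersection number of a cycle divisor is linear in the cycle**: on a regular `X`, for a finite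
set `F` of codimension-one points and multiplicities `W`, the divisor of `∏_{η ∈ F} 𝓘_{E_η}^{W η}` meets the
exceptional curve `E_{η₀}` with degree `Σ_{η ∈ F} W η · ([E_η]·E_{η₀})` — the lattice pairing
`Σ_j W_j M j i` with `M j i := excCurveDegree π [E_j] η_i`. [cite: Lipman1969, Section 12, Remark 2 b) (p. 221)] -/
theorem excCurveDegree_cycleDivisor (hX : Scheme.IsRegular X) (F : Finset X) (W : X → ℕ)
    (hF : ∀ η ∈ F, coheight η = 1) {η₀ : X} (hη₀ : η₀ ∈ excCurvePoints π)
    (h : IsEffectiveCartier (∏ η ∈ F, primeDivisorIdeal η ^ W η)) :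
    excCurveDegree π (CartierDivisor.ofIsEffectiveCartier (∏ η ∈ F, primeDivisorIdeal η ^ W η) h) η₀ =
      ∑ η ∈ F.attach, (W η : ℤ) * excCurveDegree π (CartierDivisor.ofIsEffectiveCartier
        (primeDivisorIdeal (η : X)) (isEffectiveCartier_primeDivisorIdeal_of_isRegular hX (hF η η.2))) η₀ := by
  have hK : ∀ η : {η // η ∈ F}, IsEffectiveCartier (primeDivisorIdeal (η : X) ^ W η) := fun η =>
    (isEffectiveCartier_primeDivisorIdeal_of_isRegular hX (hF η η.2)).pow _
  have hprod : ∏ η ∈ F, primeDivisorIdeal η ^ W η = ∏ η ∈ F.attach, primeDivisorIdeal (η : X) ^ W η :=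
    (Finset.prod_attach F fun η => primeDivisorIdeal η ^ W η).symm
  rw [excCurveDegree_ofIsEffectiveCartier_congr π hprod h
      (IsEffectiveCartier.finset_prod F.attach fun η _ => hK η),
    excCurveDegree_ofIsEffectiveCartier_finset_prod π hη₀ F.attach _ hK]
  refine Finset.sum_congr rfl fun η _ => ?_
  exact excCurveDegree_ofIsEffectiveCartier_pow π hη₀ _ _ _ _

/-- **Off-diagonal entries of the intersection matrix are non-negative**: for distinct integral
exceptional curves `η ≠ η₀` on a regular `X`, `([E_η]·E_{η₀}) ≥ 0` (`[E_η]` is effective and avoids the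
generic point `η₀`, which no other codimension-one point specialises to). This is the hypothesis `hoff`
of the lattice half `…PersistencePointedCycles`. [cite: Lipman1969, Section 12, Remark 2 c) (p. 221)] -/
theorem excCurveDegree_primeDivisor_nonneg_of_ne (hX : Scheme.IsRegular X) {η η₀ : X}
    (hη : coheight η = 1) (hη₀c : coheight η₀ = 1) (hη₀ : η₀ ∈ excCurvePoints π) (hne : η ≠ η₀) :
    0 ≤ excCurveDegree π (CartierDivisor.ofIsEffectiveCartier (primeDivisorIdeal η)
      (isEffectiveCartier_primeDivisorIdeal_of_isRegular hX hη)) η₀ := by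
  refine excCurveDegree_nonneg_of_isEffective π hη₀
    (CartierDivisor.isEffective_ofIsEffectiveCartier _ _) ?_
  rw [CartierDivisor.avoids_ofIsEffectiveCartier_iff, mem_support_primeDivisorIdeal_iff]
  exact not_specializes_of_coheight_eq_one hη hη₀c hne

end Degree

end Summit.ResolutionOfSingularities.ResolutionOfSingularities.Theorems.HomologicalConductor.PersistencePointedCeiling

end
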